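import Literature.AlgebraicGeometry.HodgeTheory.QbarFamilyLocalSystem                    -- ★ `IsHomotopicallyLocallyTrivialOn.isIntegralClass_transportFun` (the engine)
import Literature.AlgebraicGeometry.HodgeTheory.HodgeGenericTypeStabilityOfGenericPoint   -- ★ `exists_ratTransport`, `transportFun_transportFun_symm`
import Literature.AlgebraicGeometry.HodgeTheory.AlgebraicMonodromyMumfordTate             -- ★ `IsRatTransport` (+ `.symm`)
import Literature.AlgebraicGeometry.HodgeTheory.IntermediateJacobianComplexTorus          -- ★ `integralLattice` `Hᵏ(X;ℤ)/tors ⊂ Hᵏ(X;ℚ)`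
import HarnessLib

/-!
# Parallel transport carries the integral lattice `Hᵏ(X_s; ℤ)/tors` ONTO `Hᵏ(X_t; ℤ)/tors`, hence integral frames to
# integral frames (`Rᵏ f_* ℤ/tors ⊂ Rᵏ f_* ℚ` is a sub-local system with bijective transition maps)

Topic `AlgebraicGeometry/HodgeTheory`; namespace `Literature.AlgebraicGeometry.HodgeTheory`.  THEOREMS ONLY (no definition, no
named fact, no instance, no `sorry`).  Cell hodgecm-mathlib (D-0151), (U)-HEAD node U-e, socket P4, leaf **(S1-frame)** of B-p05
(g13)'s round-2 census (`B-provers/B-p05/CENSUS-Ue-P4-round2.B-p05g13.md` §1/§4; GO 2026-08-29T14:14:01Z; hand B-p03 (g13)):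
the input of (b1-F) «the transported lattice classes of `m₀`'s uniformisation are the lattice classes of SOME re-based
uniformisation of `X_x`».  HC_CM is proved only modulo the 7 printed citations until rung 0 closes; books 0.

[VoisinHodgeI2002, Rem. 10.17]: «the integral structure … is flat»; [VoisinHodgeII2003, §3.1.2]: the local systems
`Rᵏ f_* ℤ ⊂ Rᵏ f_* ℚ ⊂ Rᵏ f_* ℂ` of a smooth proper family.  The tree's ENGINE is CLASS-LEVEL integrality of transport in ONE
direction (★ `IsHomotopicallyLocallyTrivialOn.isIntegralClass_transportFun`, `QbarFamilyLocalSystem` :145; smooth projective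
families :197).  This file adds the FRAME form the uniformisation road consumes:

* `IsHomotopicallyLocallyTrivialOn.isIntegralClass_transportFun_iff` / `…isIntegralClass_iff_exists_transportFun_eq` —
  transport along `γ` is a BIJECTION of integral classes `Hᵏ(X_s(ℂ); ℤ)/tors → Hᵏ(X_t(ℂ); ℤ)/tors` (back along `γ⁻¹`);
* `IsRatTransport.mem_integralLattice_iff`, `IsRatTransport.map_integralLattice` — the rational transport
  `T : Hᵏ(X_s; ℚ) ≃ Hᵏ(X_t; ℚ)` (★ `IsRatTransport`, it exists: ★ `exists_ratTransport`) maps ★ `integralLattice (X_s) k` ONTO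
  ★ `integralLattice (X_t) k` (as `ℤ`-submodules, `Submodule.map`);
* `IsRatTransport.exists_integralLattice_linearEquiv` — hence restricts to a `ℤ`-linear isomorphism of the integral lattices,
  and `IsRatTransport.exists_basis_integralLattice_eq` — carries every `ℤ`-BASIS of `Hᵏ(X_s; ℤ)/tors` to a `ℤ`-basis of
  `Hᵏ(X_t; ℤ)/tors` with the SAME coordinates for transported classes (an integral / unimodular frame stays one);
* `…_of_isSmoothProjectiveFamily` — the same for a smooth projective family over a quasi-projective base smooth of pure
  dimension `d` over all of `S(ℂ)` (the hypothesis shape of ★ `isCohomologicallyLocallyTrivialOn_univ_of_isSmoothProjectiveFamily`,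
  which is p712353's `hU` for the universal family of the Siegel fine moduli scheme), including the EXISTENCE of the
  rational transport along every homotopy class of paths.

## References
* [VoisinHodgeI2002] C. Voisin, *Hodge Theory and Complex Algebraic Geometry I*, CUP 2002, §9.2.1 (local systems and
  transport), Rem. 10.17 (the integral structure is flat), §7.1.1 (the integral lattice).
* [VoisinHodgeII2003] C. Voisin, *Hodge Theory and Complex Algebraic Geometry II*, CUP 2003, §3.1.2 (the local systems
  `Rᵏ f_* ℤ`, `Rᵏ f_* ℚ`; monodromy representation).
-/

set_option autoImplicit false

noncomputable section

open CategoryTheory AlgebraicGeometry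
open _root_.Topology
open Literature.AlgebraicTopology.SingularHomology
open Literature.AlgebraicGeometry.Motives (SchemeOver ComplexPoints fiberOver bettiCohomology)

namespace Literature.AlgebraicGeometry.HodgeTheory

section IntegralTransport

variable {𝒳 S : SchemeOver ℂ} (f : 𝒳 ⟶ S) (k : ℕ) {U : Set (ComplexPoints S)}

/-! ### §1 Class level: transport is a bijection of integral classes -/

/-- **Transport along `γ` detects integrality**: `γ_* α` is integral iff `α` is (★ one-way engine along `γ` and along `γ⁻¹`,
`γ⁻¹_* γ_* = id`). [cite: VoisinHodgeI2002, Rem. 10.17 and §9.2.1] -/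
theorem IsHomotopicallyLocallyTrivialOn.isIntegralClass_transportFun_iff (hUh : IsHomotopicallyLocallyTrivialOn f U)
    (hU : IsCohomologicallyLocallyTrivialOn f U) {s t : U} (γ : Path.Homotopic.Quotient s t)
    (α : complexBetti (fiberOver f s.1) k) :
    IsIntegralClass (transportFun f k hU γ α) ↔ IsIntegralClass α := by
  refine ⟨fun h ↦ ?_, fun h ↦ hUh.isIntegralClass_transportFun f k γ h⟩
  have h' := hUh.isIntegralClass_transportFun f k γ.symm h
  rwa [transportFun_symm_transportFun] at h'

/-- **Transport along `γ` maps the integral classes of `X_s` ONTO those of `X_t`**: `β ∈ Hᵏ(X_t(ℂ); ℂ)` is integral iff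
`β = γ_* α` for an integral `α ∈ Hᵏ(X_s(ℂ); ℂ)` (namely `α := γ⁻¹_* β`).  This is «`Rᵏ f_* ℤ/tors` is a local system with
bijective transition maps». [cite: VoisinHodgeI2002, Rem. 10.17 and §9.2.1] [cite: VoisinHodgeII2003, §3.1.2] -/
theorem IsHomotopicallyLocallyTrivialOn.isIntegralClass_iff_exists_transportFun_eq
    (hUh : IsHomotopicallyLocallyTrivialOn f U) (hU : IsCohomologicallyLocallyTrivialOn f U) {s t : U}
    (γ : Path.Homotopic.Quotient s t) (β : complexBetti (fiberOver f t.1) k) :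
    IsIntegralClass β ↔ ∃ α : complexBetti (fiberOver f s.1) k, IsIntegralClass α ∧ transportFun f k hU γ α = β := by
  refine ⟨fun h ↦ ⟨transportFun f k hU γ.symm β, hUh.isIntegralClass_transportFun f k γ.symm h,
    transportFun_transportFun_symm f k hU γ β⟩, ?_⟩
  rintro ⟨α, hα, rfl⟩
  exact hUh.isIntegralClass_transportFun f k γ hα

/-! ### §2 The rational transport maps the integral lattice onto the integral lattice -/

variable {f k}

/-- **A rational transport carries the integral lattice into the integral lattice**: for `T` the rational transport along
`γ` (★ `IsRatTransport`: `(T v) ⊗ 1 = γ_* (v ⊗ 1)`) and `x ∈ Hᵏ(X_s; ℤ)/tors ⊂ Hᵏ(X_s; ℚ)` (★ `integralLattice`),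
`T x ∈ Hᵏ(X_t; ℤ)/tors`. [cite: VoisinHodgeI2002, Rem. 10.17] [cite: VoisinHodgeII2003, §3.1.2] -/
theorem IsRatTransport.mem_integralLattice (hUh : IsHomotopicallyLocallyTrivialOn f U)
    {hU : IsCohomologicallyLocallyTrivialOn f U} {s t : U} {γ : Path.Homotopic.Quotient s t}
    {T : bettiCohomology (fiberOver f s.1) k ≃ₗ[ℚ] bettiCohomology (fiberOver f t.1) k}
    (hT : IsRatTransport f k hU γ T) {x : bettiCohomology (fiberOver f s.1) k}
    (hx : x ∈ integralLattice (fiberOver f s.1) k) : T x ∈ integralLattice (fiberOver f t.1) k := by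
  rw [mem_integralLattice_iff] at hx ⊢
  rw [hT x]
  exact hUh.isIntegralClass_transportFun f k γ hx

/-- **A rational transport detects the integral lattice**: `T x` is in `Hᵏ(X_t; ℤ)/tors` iff `x` is in `Hᵏ(X_s; ℤ)/tors`
(`T⁻¹` is the rational transport along `γ⁻¹`, ★ `IsRatTransport.symm`). [cite: VoisinHodgeI2002, Rem. 10.17]
[cite: VoisinHodgeII2003, §3.1.2] -/
theorem IsRatTransport.mem_integralLattice_iff (hUh : IsHomotopicallyLocallyTrivialOn f U)
    {hU : IsCohomologicallyLocallyTrivialOn f U} {s t : U} {γ : Path.Homotopic.Quotient s t}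
    {T : bettiCohomology (fiberOver f s.1) k ≃ₗ[ℚ] bettiCohomology (fiberOver f t.1) k}
    (hT : IsRatTransport f k hU γ T) (x : bettiCohomology (fiberOver f s.1) k) :
    T x ∈ integralLattice (fiberOver f t.1) k ↔ x ∈ integralLattice (fiberOver f s.1) k := by
  refine ⟨fun h ↦ ?_, hT.mem_integralLattice hUh⟩
  have h' := hT.symm.mem_integralLattice hUh h
  rwa [LinearEquiv.symm_apply_apply] at h'

/-- **The rational transport maps the integral lattice ONTO the integral lattice** (as `ℤ`-submodules of the rational
cohomology: `T(Hᵏ(X_s; ℤ)/tors) = Hᵏ(X_t; ℤ)/tors`). [cite: VoisinHodgeI2002, Rem. 10.17] [cite: VoisinHodgeII2003, §3.1.2] -/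
theorem IsRatTransport.map_integralLattice (hUh : IsHomotopicallyLocallyTrivialOn f U)
    {hU : IsCohomologicallyLocallyTrivialOn f U} {s t : U} {γ : Path.Homotopic.Quotient s t}
    {T : bettiCohomology (fiberOver f s.1) k ≃ₗ[ℚ] bettiCohomology (fiberOver f t.1) k}
    (hT : IsRatTransport f k hU γ T) :
    (integralLattice (fiberOver f s.1) k).map
        (T.toAddEquiv.toIntLinearEquiv : bettiCohomology (fiberOver f s.1) k →ₗ[ℤ] bettiCohomology (fiberOver f t.1) k) =
      integralLattice (fiberOver f t.1) k := by
  ext y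
  simp only [Submodule.mem_map, LinearEquiv.coe_coe, AddEquiv.coe_toIntLinearEquiv, LinearEquiv.coe_toAddEquiv]
  constructor
  · rintro ⟨x, hx, rfl⟩
    exact hT.mem_integralLattice hUh hx
  · intro hy
    exact ⟨T.symm y, (hT.mem_integralLattice_iff hUh _).1 (by rwa [LinearEquiv.apply_symm_apply]),
      T.apply_symm_apply y⟩

/-- **The rational transport restricts to a `ℤ`-linear isomorphism of the integral lattices**
`Hᵏ(X_s; ℤ)/tors ≃ Hᵏ(X_t; ℤ)/tors` (existence form; THEOREMS ONLY — the isomorphism is `LinearEquiv.ofSubmodules` of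
`map_integralLattice`). [cite: VoisinHodgeI2002, Rem. 10.17] [cite: VoisinHodgeII2003, §3.1.2] -/
theorem IsRatTransport.exists_integralLattice_linearEquiv (hUh : IsHomotopicallyLocallyTrivialOn f U)
    {hU : IsCohomologicallyLocallyTrivialOn f U} {s t : U} {γ : Path.Homotopic.Quotient s t}
    {T : bettiCohomology (fiberOver f s.1) k ≃ₗ[ℚ] bettiCohomology (fiberOver f t.1) k}
    (hT : IsRatTransport f k hU γ T) :
    ∃ e : integralLattice (fiberOver f s.1) k ≃ₗ[ℤ] integralLattice (fiberOver f t.1) k,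
      ∀ x, (e x : bettiCohomology (fiberOver f t.1) k) = T x :=
  ⟨T.toAddEquiv.toIntLinearEquiv.ofSubmodules _ _ (hT.map_integralLattice hUh), fun _ ↦ rfl⟩

/-- **INTEGRAL FRAMES ARE TRANSPORTED TO INTEGRAL FRAMES**: a `ℤ`-basis `b` of `Hᵏ(X_s; ℤ)/tors` is carried by the rational
transport `T` to a `ℤ`-basis `b′` of `Hᵏ(X_t; ℤ)/tors`, `b′ i = T (b i)`, and the coordinates of `T x` in `b′` are those of `x`
in `b` (so a unimodular frame of the lattice stays unimodular, and Gram matrices computed in the frame are transported entry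
by entry).  This is the (S1-frame) input of the uniformisation road: the transported lattice classes form again a `ℤ`-basis
of the integral lattice. [cite: VoisinHodgeI2002, Rem. 10.17] [cite: VoisinHodgeII2003, §3.1.2] -/
theorem IsRatTransport.exists_basis_integralLattice_eq (hUh : IsHomotopicallyLocallyTrivialOn f U)
    {hU : IsCohomologicallyLocallyTrivialOn f U} {s t : U} {γ : Path.Homotopic.Quotient s t}
    {T : bettiCohomology (fiberOver f s.1) k ≃ₗ[ℚ] bettiCohomology (fiberOver f t.1) k}
    (hT : IsRatTransport f k hU γ T) {ι : Type*} (b : Module.Basis ι ℤ (integralLattice (fiberOver f s.1) k)) :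
    ∃ b' : Module.Basis ι ℤ (integralLattice (fiberOver f t.1) k),
      (∀ i, (b' i : bettiCohomology (fiberOver f t.1) k) = T (b i)) ∧
      ∀ (x : integralLattice (fiberOver f s.1) k) (hTx : T x ∈ integralLattice (fiberOver f t.1) k) (i : ι),
        b'.repr ⟨T x, hTx⟩ i = b.repr x i := by
  obtain ⟨e, he⟩ := hT.exists_integralLattice_linearEquiv hUh
  refine ⟨b.map e, fun i ↦ by rw [Module.Basis.map_apply, he], fun x hTx i ↦ ?_⟩
  have hx : (⟨T x, hTx⟩ : integralLattice (fiberOver f t.1) k) = e x := Subtype.ext (he x).symm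
  rw [hx, Module.Basis.map_repr, LinearEquiv.trans_apply, LinearEquiv.symm_apply_apply]

/-! ### §3 Smooth projective families over a quasi-projective base smooth of pure dimension `d` -/

variable (f k)

/-- **Existence of the rational transport along every homotopy class of paths in `S(ℂ)`** for a smooth projective family
over a quasi-projective base smooth of pure dimension `d` (★ `exists_ratTransport` fed with ★
`isRationalClass_transportFun_of_isSmoothProjectiveFamily`), stated for ANY proof `hU` of cohomological local triviality
(the carrier `transportFun f k hU` does not depend on it). [cite: VoisinHodgeII2003, §3.1.2] -/
theorem exists_isRatTransport_of_isSmoothProjectiveFamily {n : ℕ} (d : ℕ) (hf : Motives.IsSmoothProjectiveFamily f n)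
    (hS : IsQuasiProjectiveOver S) [SmoothOfRelativeDimension d S.hom]
    (hU : IsCohomologicallyLocallyTrivialOn f (Set.univ : Set (ComplexPoints S)))
    {s t : (Set.univ : Set (ComplexPoints S))} (γ : Path.Homotopic.Quotient s t) :
    ∃ T : bettiCohomology (fiberOver f s.1) k ≃ₗ[ℚ] bettiCohomology (fiberOver f t.1) k, IsRatTransport f k hU γ T :=
  exists_ratTransport f k hU
    (fun _ _ γ' _ hα ↦ isRationalClass_transportFun_of_isSmoothProjectiveFamily f k d hf hS γ' hα) γ

/-- The instances behind `isCohomologicallyLocallyTrivialOn_univ_of_isSmoothProjectiveFamily` make the family homotopically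
locally trivial over all of `S(ℂ)` (Ehresmann on complex points, ★ `isHomotopicallyLocallyTrivialOn_univ`).
[cite: VoisinHodgeI2002, Thm. 9.3 and §9.2.1] -/
theorem isHomotopicallyLocallyTrivialOn_univ_of_isSmoothProjectiveFamily {n : ℕ} (d : ℕ)
    (hf : Motives.IsSmoothProjectiveFamily f n) (hS : IsQuasiProjectiveOver S) [SmoothOfRelativeDimension d S.hom] :
    IsHomotopicallyLocallyTrivialOn f (Set.univ : Set (ComplexPoints S)) := by
  haveI : LocallyOfFiniteType S.hom := hS.locallyOfFiniteType
  haveI : IsSeparated S.hom := hS.isVarietyPair_ofScheme.isSeparated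
  haveI : QuasiCompact S.hom := hS.isVarietyPair_ofScheme.quasiCompact
  haveI : CompactSpace S.left := QuasiCompact.compactSpace_of_compactSpace S.hom
  haveI := hf.smoothOfRelativeDimension
  haveI := hf.isProper
  exact isHomotopicallyLocallyTrivialOn_univ f n d

/-- **For a smooth projective family, transport along `γ` detects integrality** (`γ_* α` integral iff `α` integral), for any
proof `hU` of cohomological local triviality over `S(ℂ)`. [cite: VoisinHodgeI2002, Rem. 10.17] -/
theorem isIntegralClass_transportFun_iff_of_isSmoothProjectiveFamily {n : ℕ} (d : ℕ)
    (hf : Motives.IsSmoothProjectiveFamily f n) (hS : IsQuasiProjectiveOver S) [SmoothOfRelativeDimension d S.hom]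
    (hU : IsCohomologicallyLocallyTrivialOn f (Set.univ : Set (ComplexPoints S)))
    {s t : (Set.univ : Set (ComplexPoints S))} (γ : Path.Homotopic.Quotient s t) (α : complexBetti (fiberOver f s.1) k) :
    IsIntegralClass (transportFun f k hU γ α) ↔ IsIntegralClass α :=
  (isHomotopicallyLocallyTrivialOn_univ_of_isSmoothProjectiveFamily f d hf hS).isIntegralClass_transportFun_iff f k hU γ α

/-- **For a smooth projective family, the rational transport maps `Hᵏ(X_s; ℤ)/tors` ONTO `Hᵏ(X_t; ℤ)/tors`.**
[cite: VoisinHodgeI2002, Rem. 10.17] [cite: VoisinHodgeII2003, §3.1.2] -/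
theorem IsRatTransport.map_integralLattice_of_isSmoothProjectiveFamily {n : ℕ} (d : ℕ)
    (hf : Motives.IsSmoothProjectiveFamily f n) (hS : IsQuasiProjectiveOver S) [SmoothOfRelativeDimension d S.hom]
    {hU : IsCohomologicallyLocallyTrivialOn f (Set.univ : Set (ComplexPoints S))}
    {s t : (Set.univ : Set (ComplexPoints S))} {γ : Path.Homotopic.Quotient s t}
    {T : bettiCohomology (fiberOver f s.1) k ≃ₗ[ℚ] bettiCohomology (fiberOver f t.1) k} (hT : IsRatTransport f k hU γ T) :
    (integralLattice (fiberOver f s.1) k).map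
        (T.toAddEquiv.toIntLinearEquiv : bettiCohomology (fiberOver f s.1) k →ₗ[ℤ] bettiCohomology (fiberOver f t.1) k) =
      integralLattice (fiberOver f t.1) k :=
  hT.map_integralLattice (isHomotopicallyLocallyTrivialOn_univ_of_isSmoothProjectiveFamily f d hf hS)

/-- **For a smooth projective family, integral frames are transported to integral frames**: along every homotopy class of
paths `γ` in `S(ℂ)` there is a rational transport `T`, and it carries any `ℤ`-basis `b` of `Hᵏ(X_s; ℤ)/tors` to a `ℤ`-basis
`b′` of `Hᵏ(X_t; ℤ)/tors` with `b′ i = T (b i)` (the (S1-frame) statement the uniformisation road of U-e P4b consumes,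
for the universal family of the Siegel fine moduli scheme restricted to a smooth open piece).
[cite: VoisinHodgeI2002, Rem. 10.17] [cite: VoisinHodgeII2003, §3.1.2] -/
theorem exists_isRatTransport_basis_integralLattice_of_isSmoothProjectiveFamily {n : ℕ} (d : ℕ)
    (hf : Motives.IsSmoothProjectiveFamily f n) (hS : IsQuasiProjectiveOver S) [SmoothOfRelativeDimension d S.hom]
    (hU : IsCohomologicallyLocallyTrivialOn f (Set.univ : Set (ComplexPoints S)))
    {s t : (Set.univ : Set (ComplexPoints S))} (γ : Path.Homotopic.Quotient s t)
    {ι : Type*} (b : Module.Basis ι ℤ (integralLattice (fiberOver f s.1) k)) :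
    ∃ (T : bettiCohomology (fiberOver f s.1) k ≃ₗ[ℚ] bettiCohomology (fiberOver f t.1) k)
      (b' : Module.Basis ι ℤ (integralLattice (fiberOver f t.1) k)),
      IsRatTransport f k hU γ T ∧ ∀ i, (b' i : bettiCohomology (fiberOver f t.1) k) = T (b i) := by
  obtain ⟨T, hT⟩ := exists_isRatTransport_of_isSmoothProjectiveFamily f k d hf hS hU γ
  obtain ⟨b', hb', -⟩ :=
    hT.exists_basis_integralLattice_eq (isHomotopicallyLocallyTrivialOn_univ_of_isSmoothProjectiveFamily f d hf hS) b
  exact ⟨T, b', hT, hb'⟩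

end IntegralTransport

end Literature.AlgebraicGeometry.HodgeTheory

end
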